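import Literature.AlgebraicGeometry.HodgeTheory.FermatHodgeCharacterRigidity
import Literature.AlgebraicGeometry.HodgeTheory.FermatHodgeCharacterUGroup
import HarnessLib

/-!
# Short character-sum configurations, I: null ones vanish

Crux `HodgeFermatVarieties` (stmt-HodgeConjecture-1334), line `cancel-by-any-claim-lattice`, stub S6
`stub_pairedOfLargePrimes` (lead c2): the ANALYTIC half of "every prime factor of `m` large ⟹ every
Hodge character of `Xⁿₘ` is paired" (the `𝔅 = 𝔇` direction of Aoki 1983 Thm A). Two statements about
a function `T : ℤ/N → ℂ` supported on units whose character sums `∑ₓ T(x) χ(x)` vanish: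

* `eq_zero_of_null` — if the sums vanish for EVERY primitive character mod `N` ("null") and the
  support of `T` has at most `p - 2` points for every prime `p ∣ N`, then `T = 0`. Proof: peel the
  prime power `q = pᵉ ∥ N`; a free residue class mod `q` exists by counting, so every slice
  `b ↦ T(crt(a, b))` is null at level `N/q` (local Fourier lemma `parityPart_mul_eq_of_orthogonal`
  of `FermatHodgeCharacterLocal`, both parities) and the induction hypothesis applies to it.
* (sequel file `…PairedOfLargePrimesEven`) `even_of_oddNull` — if every prime factor of `N` is
  `≥ 5`, the sums vanish for every ODD primitive character mod `N`, and the support has at most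
  `p - 3` points for every prime `p ∣ N`, then `T(-x) = T(x)`.

Everything here is proved; no named facts. The arithmetic application (Hodge characters) is the
file `…PairedOfLargePrimes`.

References: [Aoki1983] N. Aoki, Math. Ann. 266 (1983) 23–54, §§3–6 (Prop. 6.4: the pair-splitting
under `p > ℓ`), text read through the tree files `FermatHodgeCharacter*`.
-/

set_option linter.dupNamespace false

noncomputable section

open Finset
open Literature.AlgebraicGeometry.HodgeTheory Literature.AlgebraicGeometry.HodgeTheory.FermatCharacter

namespace Summit.HodgeConjecture.HodgeConjecture.Theorems.CancelByAnyClaimLattice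

namespace PairedNull

section CRT

variable {q n : ℕ}

/-- The components of `crt⁻¹(a, b)`: reduction mod `q` gives `a`, reduction mod `n` gives `b`.
[folklore] -/
theorem castHom_crt_symm (h : q.Coprime n) (a : ZMod q) (b : ZMod n) :
    ZMod.castHom (dvd_mul_right q n) (ZMod q) ((ZMod.chineseRemainder h).symm (a, b)) = a ∧
    ZMod.castHom (dvd_mul_left n q) (ZMod n) ((ZMod.chineseRemainder h).symm (a, b)) = b := by
  have h1 : ZMod.chineseRemainder h ((ZMod.chineseRemainder h).symm (a, b)) = (a, b) :=
    RingEquiv.apply_symm_apply _ _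
  have hfst : ∀ x : ZMod (q * n), (ZMod.chineseRemainder h x).1 =
      ZMod.castHom (dvd_mul_right q n) (ZMod q) x := fun x ↦ by
    change ((ZMod.cast x : ZMod q × ZMod n)).1 = _
    rw [Prod.fst_zmod_cast, ZMod.castHom_apply]
  have hsnd : ∀ x : ZMod (q * n), (ZMod.chineseRemainder h x).2 =
      ZMod.castHom (dvd_mul_left n q) (ZMod n) x := fun x ↦ by
    change ((ZMod.cast x : ZMod q × ZMod n)).2 = _
    rw [Prod.snd_zmod_cast, ZMod.castHom_apply]
  exact ⟨by rw [← hfst, h1], by rw [← hsnd, h1]⟩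

/-- `crt⁻¹(a, b)` is a unit iff `a` and `b` are (for `q, n ≥ 1` coprime). [folklore] -/
theorem isUnit_crt_symm_iff [NeZero q] [NeZero n] (h : q.Coprime n) (a : ZMod q) (b : ZMod n) :
    IsUnit ((ZMod.chineseRemainder h).symm (a, b)) ↔ IsUnit a ∧ IsUnit b := by
  rw [isUnit_iff_of_coprime, (castHom_crt_symm h a b).1, (castHom_crt_symm h a b).2]

/-- `crt⁻¹(-a, -b) = -crt⁻¹(a, b)`. [folklore] -/
theorem crt_symm_neg (h : q.Coprime n) (a : ZMod q) (b : ZMod n) :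
    (ZMod.chineseRemainder h).symm (-a, -b) = -(ZMod.chineseRemainder h).symm (a, b) := by
  rw [← map_neg]; rfl

/-- Every `x` is `crt⁻¹` of its two reductions. [folklore] -/
theorem crt_symm_castHom (h : q.Coprime n) (x : ZMod (q * n)) :
    (ZMod.chineseRemainder h).symm (ZMod.castHom (dvd_mul_right q n) (ZMod q) x,
      ZMod.castHom (dvd_mul_left n q) (ZMod n) x) = x := by
  have hfst : (ZMod.chineseRemainder h x).1 = ZMod.castHom (dvd_mul_right q n) (ZMod q) x := by
    change ((ZMod.cast x : ZMod q × ZMod n)).1 = _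
    rw [Prod.fst_zmod_cast, ZMod.castHom_apply]
  have hsnd : (ZMod.chineseRemainder h x).2 = ZMod.castHom (dvd_mul_left n q) (ZMod n) x := by
    change ((ZMod.cast x : ZMod q × ZMod n)).2 = _
    rw [Prod.snd_zmod_cast, ZMod.castHom_apply]
  rw [← hfst, ← hsnd, Prod.mk.eta, RingEquiv.symm_apply_apply]

/-- **Fubini over the fibres of reduction mod `q`**: a sum over `ℤ/(qn)` is the sum over `a mod q`
of the sums over the fibre `b ↦ crt⁻¹(a, b)`. [folklore] -/
theorem sum_eq_sum_crt [NeZero q] [NeZero n] (h : q.Coprime n) (G : ZMod (q * n) → ℂ) :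
    ∑ x : ZMod (q * n), G x = ∑ a : ZMod q, ∑ b : ZMod n, G ((ZMod.chineseRemainder h).symm (a, b)) := by
  rw [← Equiv.sum_comp (ZMod.chineseRemainder h).symm.toEquiv, Fintype.sum_prod_type]
  rfl

end CRT

section Slice

variable {q n : ℕ} [NeZero q] [NeZero n]

/-- **Null configurations have kernel-invariant slices** (function form of `slice_invariant`):
if `∑ₓ T(x) χ(x) = 0` for every primitive `χ` mod `qn`, `d ∣ q` and every character mod `q` not
factoring through `d` is primitive, then for every primitive `χ₂` mod `n` the slice
`F(a) = ∑_b T(crt⁻¹(a, b)) χ₂(b)` satisfies `F(uy) = F(y)` for units `y` and `u ≡ 1 (mod d)`.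
[cite: Aoki1983, Lemma 3.2 / Cor. 3.4] -/
theorem slice_eq_of_null (h : q.Coprime n) {d : ℕ} (hd : d ∣ q)
    (hprim : ∀ χ : DirichletCharacter ℂ q, ¬ χ.FactorsThrough d → χ.IsPrimitive)
    (T : ZMod (q * n) → ℂ)
    (hT : ∀ χ : DirichletCharacter ℂ (q * n), χ.IsPrimitive → ∑ x : ZMod (q * n), T x * χ x = 0)
    (χ₂ : DirichletCharacter ℂ n) (hχ₂ : χ₂.IsPrimitive) (u y : (ZMod q)ˣ)
    (hu : ZMod.unitsMap hd u = 1) :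
    ∑ b : ZMod n, T ((ZMod.chineseRemainder h).symm ((u : ZMod q) * y, b)) * χ₂ b =
      ∑ b : ZMod n, T ((ZMod.chineseRemainder h).symm (y, b)) * χ₂ b := by
  classical
  haveI : NeZero (q * n) := ⟨mul_ne_zero (NeZero.ne q) (NeZero.ne n)⟩
  set F : ZMod q → ℂ := fun a ↦ ∑ b : ZMod n, T ((ZMod.chineseRemainder h).symm (a, b)) * χ₂ b
    with hF
  have horth : ∀ ε : ℂ, ∀ χ : DirichletCharacter ℂ q, χ (-1) = ε → ¬ χ.FactorsThrough d →
      ∑ a : ZMod q, F a * χ a = 0 := by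
    intro ε χ _ hχ
    have key := hT _ (prodChar_isPrimitive h (hprim χ hχ) hχ₂)
    rw [sum_mul_prodChar_eq h] at key
    rw [← key]
    exact Finset.sum_congr rfl fun a _ ↦ by rw [hF, mul_comm]
  have h1 := parityPart_mul_eq_of_orthogonal hd F (Or.inl rfl) (horth 1) u y hu
  have h2 := parityPart_mul_eq_of_orthogonal hd F (Or.inr rfl) (horth (-1)) u y hu
  have h3 : (2 : ℂ) * F ((u : ZMod q) * y) = 2 * F y := by linear_combination h1 + h2
  exact mul_left_cancel₀ (two_ne_zero (α := ℂ)) h3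

/-- **A free residue class kills its whole kernel coset of slices**: in the setting of
`slice_eq_of_null`, if no point of the support of `T` reduces to `u·y` mod `q`, then the slice at `y`
is null at level `n`: `∑_b T(crt⁻¹(y, b)) χ₂(b) = 0` for every primitive `χ₂` mod `n`.
[cite: Aoki1983, Cor. 3.4] -/
theorem slice_null_of_free (h : q.Coprime n) {d : ℕ} (hd : d ∣ q)
    (hprim : ∀ χ : DirichletCharacter ℂ q, ¬ χ.FactorsThrough d → χ.IsPrimitive)
    (T : ZMod (q * n) → ℂ)
    (hT : ∀ χ : DirichletCharacter ℂ (q * n), χ.IsPrimitive → ∑ x : ZMod (q * n), T x * χ x = 0)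
    (y u : (ZMod q)ˣ) (hu : ZMod.unitsMap hd u = 1)
    (hfree : ∀ x : ZMod (q * n), T x ≠ 0 → ZMod.castHom (dvd_mul_right q n) (ZMod q) x ≠ (u : ZMod q) * y)
    (χ₂ : DirichletCharacter ℂ n) (hχ₂ : χ₂.IsPrimitive) :
    ∑ b : ZMod n, T ((ZMod.chineseRemainder h).symm (y, b)) * χ₂ b = 0 := by
  rw [← slice_eq_of_null h hd hprim T hT χ₂ hχ₂ u y hu]
  refine Finset.sum_eq_zero fun b _ ↦ ?_
  have : T ((ZMod.chineseRemainder h).symm ((u : ZMod q) * y, b)) = 0 := by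
    by_contra hne
    exact hfree _ hne (castHom_crt_symm h _ b).1
  rw [this, zero_mul]

end Slice

/-! ### Null configurations with short support vanish -/

section Null

/-- The prime-power factorisation step used by the inductions: `N > 1` is `pᵉ · n` with `p` the
least prime factor, `e ≥ 1`, `p ∤ n`. [folklore] -/
theorem exists_primePow_mul {N : ℕ} (hN0 : N ≠ 0) (hN1 : N ≠ 1) :
    ∃ p e n : ℕ, p.Prime ∧ 1 ≤ e ∧ ¬ p ∣ n ∧ (p ^ e).Coprime n ∧ N = p ^ e * n := by
  set p := N.minFac
  have hp : p.Prime := Nat.minFac_prime hN1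
  obtain ⟨e, n, hpn, hN⟩ := Nat.exists_eq_pow_mul_and_not_dvd hN0 p hp.ne_one
  refine ⟨p, e, n, hp, ?_, hpn, (hp.coprime_iff_not_dvd.2 hpn).pow_left e, hN⟩
  by_contra he
  have he0 : e = 0 := by omega
  rw [he0, pow_zero, one_mul] at hN
  exact hpn (hN ▸ Nat.minFac_dvd N)

/-- **Null configurations with at most `p - 2` points (every `p ∣ N`) vanish.** Let
`T : ℤ/N → ℂ` be supported on units with `∑ₓ T(x) χ(x) = 0` for EVERY primitive character `χ`
mod `N`, and assume `#supp T + 1 < p` for every prime `p ∣ N`. Then `T = 0`. (Peel `q = pᵉ ∥ N`: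
a residue class mod `q` free of the support exists in every coset of
`ker((ℤ/q)ˣ → (ℤ/pᵉ⁻¹)ˣ)` by counting, so every slice is null at level `N/q`; induct.)
[cite: Aoki1983, Cor. 3.4 and Prop. 6.4 (ii)] -/
theorem eq_zero_of_null : ∀ (N : ℕ) [NeZero N] (T : ZMod N → ℂ),
    (∀ x, ¬ IsUnit x → T x = 0) →
    (∀ χ : DirichletCharacter ℂ N, χ.IsPrimitive → ∑ x : ZMod N, T x * χ x = 0) →
    (∀ p ∈ N.primeFactors, #(univ.filter fun x : ZMod N ↦ T x ≠ 0) + 1 < p) →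
    ∀ x, T x = 0 := by
  intro N
  induction N using Nat.strong_induction_on with
  | _ N ih =>
  intro _ T hTu hT hcard
  classical
  have hN0 : N ≠ 0 := NeZero.ne N
  by_cases hN1 : N = 1
  · subst hN1
    intro x
    haveI : Subsingleton (ZMod 1) := ZMod.subsingleton_iff.mpr rfl
    have key := hT 1 DirichletCharacter.isPrimitive_one_level_one
    rw [Fintype.sum_subsingleton _ x, MulChar.one_apply (isUnit_of_subsingleton _), mul_one] at key
    exact key
  obtain ⟨p, e, n, hp, he, hpn, hcop, rfl⟩ := exists_primePow_mul hN0 hN1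
  haveI : NeZero (p ^ e) := ⟨pow_ne_zero e hp.ne_zero⟩
  have hn0 : n ≠ 0 := fun h0 ↦ hN0 (by rw [h0, mul_zero])
  haveI : NeZero n := ⟨hn0⟩
  haveI : Fact (1 < p) := ⟨hp.one_lt⟩
  have hq1 : 1 < p ^ e := Nat.one_lt_pow (by omega) hp.one_lt
  have hnlt : n < p ^ e * n := lt_mul_left (Nat.pos_of_ne_zero hn0) hq1
  have hpN : p ∈ (p ^ e * n).primeFactors := by
    rw [Nat.mem_primeFactors]
    exact ⟨hp, dvd_mul_of_dvd_left (dvd_pow_self p (by omega)) n, hN0⟩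
  set S : Finset (ZMod (p ^ e * n)) := univ.filter fun x ↦ T x ≠ 0 with hS
  have hSp : #S + 1 < p := by rw [hS]; exact hcard p hpN
  -- the set of residues mod `q` of the support
  set R : Finset (ZMod (p ^ e)) := S.image (ZMod.castHom (dvd_mul_right (p ^ e) n) (ZMod (p ^ e)))
    with hR
  have hRcard : #R ≤ #S := Finset.card_image_le
  have hRmem : ∀ x, T x ≠ 0 → ZMod.castHom (dvd_mul_right (p ^ e) n) (ZMod (p ^ e)) x ∈ R :=
    fun x hx ↦ Finset.mem_image_of_mem _ (by rw [hS, mem_filter]; exact ⟨mem_univ _, hx⟩)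
  -- a free kernel translate of every unit residue
  have hfree : ∀ a : (ZMod (p ^ e))ˣ, ∃ u : (ZMod (p ^ e))ˣ,
      ZMod.unitsMap (pow_dvd_pow p (Nat.sub_le e 1)) u = 1 ∧
      ∀ x, T x ≠ 0 → ZMod.castHom (dvd_mul_right (p ^ e) n) (ZMod (p ^ e)) x ≠ (u : ZMod (p ^ e)) * a := by
    intro a
    -- the kernel `K` acts freely on residues; it has more elements than `R`
    set K : Finset (ZMod (p ^ e))ˣ := univ.filter fun u ↦
      ZMod.unitsMap (pow_dvd_pow p (Nat.sub_le e 1)) u = 1 with hK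
    have hKcard : #R < #K := by
      rcases Nat.lt_or_ge e 2 with he1 | he2
      · -- `e = 1`: the kernel is everything, `#K = p - 1`
        have he1' : e = 1 := by omega
        have hKall : K = univ := by
          rw [hK]
          refine Finset.filter_true_of_mem fun u _ ↦ ?_
          have hsub : Subsingleton (ZMod (p ^ (e - 1))) := by
            rw [he1', Nat.sub_self, pow_zero]; exact ZMod.subsingleton_iff.mpr rfl
          exact Subsingleton.elim _ _
        have htot : (p ^ e).totient = p - 1 := by rw [he1', pow_one, Nat.totient_prime hp]
        rw [hKall, Finset.card_univ, ZMod.card_units_eq_totient, htot]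
        omega
      · have hKp : #K = p := card_ker_primePow hp he2
        omega
    -- the map `u ↦ u * a` is injective on `K`, so some image misses `R`
    have hinj : Set.InjOn (fun u : (ZMod (p ^ e))ˣ ↦ ((u : ZMod (p ^ e)) * a)) K := by
      intro u _ u' _ huu
      have : (u * a : (ZMod (p ^ e))ˣ) = u' * a := Units.ext (by simpa using huu)
      exact mul_right_cancel this
    have himg : #(K.image fun u : (ZMod (p ^ e))ˣ ↦ ((u : ZMod (p ^ e)) * a)) = #K :=
      Finset.card_image_of_injOn hinj
    have hlt : #R < #(K.image fun u : (ZMod (p ^ e))ˣ ↦ ((u : ZMod (p ^ e)) * a)) := by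
      rw [himg]; exact hKcard
    obtain ⟨z, hzK, hzR⟩ := Finset.exists_mem_notMem_of_card_lt_card hlt
    obtain ⟨u, huK, rfl⟩ := Finset.mem_image.mp hzK
    refine ⟨u, (mem_filter.mp huK).2, fun x hx hxu ↦ hzR ?_⟩
    rw [← hxu]
    exact hRmem x hx
  -- every slice is null, supported on units, short: the induction hypothesis kills it
  have hslice : ∀ a : ZMod (p ^ e), IsUnit a → ∀ b : ZMod n,
      T ((ZMod.chineseRemainder hcop).symm (a, b)) = 0 := by
    intro a ha
    set Sl : ZMod n → ℂ := fun b ↦ T ((ZMod.chineseRemainder hcop).symm (a, b)) with hSl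
    have hSlu : ∀ b, ¬ IsUnit b → Sl b = 0 := by
      intro b hb
      apply hTu
      rw [isUnit_crt_symm_iff]
      exact fun hh ↦ hb hh.2
    have hSlT : ∀ χ₂ : DirichletCharacter ℂ n, χ₂.IsPrimitive → ∑ b : ZMod n, Sl b * χ₂ b = 0 := by
      intro χ₂ hχ₂
      obtain ⟨u, hu, hfr⟩ := hfree ha.unit
      have := slice_null_of_free hcop (pow_dvd_pow p (Nat.sub_le e 1))
        (fun χ hχ ↦ isPrimitive_of_not_factorsThrough_primePow hp he χ hχ) T hT ha.unit u hu hfr χ₂ hχ₂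
      simpa only [IsUnit.unit_spec] using this
    have hSlcard : ∀ p' ∈ n.primeFactors, #(univ.filter fun b : ZMod n ↦ Sl b ≠ 0) + 1 < p' := by
      intro p' hp'
      have hp'N : p' ∈ (p ^ e * n).primeFactors := by
        rw [Nat.primeFactors_mul (NeZero.ne _) hn0]
        exact Finset.mem_union_right _ hp'
      refine lt_of_le_of_lt ?_ (hcard p' hp'N)
      refine Nat.add_le_add_right (Finset.card_le_card_of_injOn
        (fun b ↦ (ZMod.chineseRemainder hcop).symm (a, b)) (fun b hb ↦ ?_) (fun b _ b' _ hbb ↦ ?_)) 1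
      · rw [Finset.mem_coe, mem_filter] at hb ⊢
        exact ⟨mem_univ _, hb.2⟩
      · have := congrArg (ZMod.chineseRemainder hcop) hbb
        simp only [RingEquiv.apply_symm_apply, Prod.mk.injEq] at this
        exact this.2
    exact ih n hnlt Sl hSlu hSlT hSlcard
  intro x
  by_cases hx : IsUnit x
  · have hxq : IsUnit (ZMod.castHom (dvd_mul_right (p ^ e) n) (ZMod (p ^ e)) x) := hx.map _
    rw [← crt_symm_castHom hcop x]
    exact hslice _ hxq _
  · exact hTu x hx

end Null

end PairedNull

end Summit.HodgeConjecture.HodgeConjecture.Theorems.CancelByAnyClaimLattice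

end
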